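import Literature.MathematicalPhysics.QuantumLattice.DWaveSourceNNNHoppingFlatTwistChord
import Literature.MathematicalPhysics.QuantumLattice.DWaveSourceNNNHoppingEnergyDensityExists
import HarnessLib

/-!
# Thermodynamic-limit ceiling on the sourced helicity chord density: `limsup_L ΔE_L(h, n_L)/L² ≤ e_src(0) − e_src(h)`

Topic `Literature/MathematicalPhysics/QuantumLattice` (namespace = path; family `hubbard`). Sequel of
`DWaveSourceNNNHoppingFlatTwistChord.lean` (finite torus: `E₀(twist n, h) − E₀(A_L(h)) ≤ E₀(A_L(0)) − E₀(A_L(h))`,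
`sourcedHelicityChord_le_sourcedGain`) and `DWaveSourceNNNHoppingEnergyDensityExists.lean` (the sourced energy density
`e_src(t',U,μ,h) = lim E₀(A_{L+1}(h))/(L+1)²` exists, `tendsto_dWaveSourceEnergyDensityTT'`). For the Hubbard cuprate
cell's row T8 (`sourced-helicity-chord`): WHATEVER twist sequence `n_L ∈ (ℤ/(L+1))²` is chosen (in particular the
card's `q ∈ (4π/L)ℤ²` ladder), the helicity chord per site is eventually below the thermodynamic sourced GAIN density
`e_src(0) − e_src(h)` plus any `ε > 0` — the a-priori ceiling `σ(h,q) ≤ G(h)` of the card's word, in the limit, with no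
existence claim for the chord's own limit.

* `tendsto_sourcedGain_div_sq`: `(E₀(A_{L+1}(0)) − E₀(A_{L+1}(h)))/(L+1)² → e_src(0) − e_src(h)`;
* **`eventually_sourcedHelicityChord_div_sq_le`**: `∀ ε > 0`, eventually in `L`,
  `(E₀(twist n_L, h) − E₀(A_{L+1}(h)))/(L+1)² ≤ e_src(t',U,μ,0) − e_src(t',U,μ,h) + ε`;
* `sourcedGainDensity_nonneg`: `0 ≤ e_src(0) − e_src(h)` for `h ≥ 0`.

HONEST SCOPE: a one-sided thermodynamic statement (ceiling) about grand-canonical energies; no number, nothing about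
superconductivity; the existence of `lim ΔE_L/L²` itself (the card's `sourcedHelicityDensity`) is NOT addressed.
All PROVED, no definition.

## References
* T. Koma, H. Tasaki, J. Stat. Phys. 76 (1994) 745–803, §1. [cite: KomaTasaki1994, §1]
* D. Ruelle, *Statistical Mechanics* (1969), §3.3 (thermodynamic limit of energy densities). [cite: Ruelle1969, §3.3]
-/

noncomputable section

namespace Literature.MathematicalPhysics.QuantumLattice

open _root_.Matrix Finset Literature.Probability.LatticeModels HubbardWave0 _root_.Filter
open scoped _root_.Topology

/-- **The sourced gain density converges**: `(E₀(A_{L+1}(0)) − E₀(A_{L+1}(h)))/(L+1)² → e_src(0) − e_src(h)`.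
[cite: Ruelle1969, §3.3] -/
theorem tendsto_sourcedGain_div_sq (t' U μ h : ℝ) :
    Tendsto (fun L : ℕ => ((dWaveSourceTorusTT' (L + 1) t' U μ 0).groundEnergy -
        (dWaveSourceTorusTT' (L + 1) t' U μ h).groundEnergy) / (((L + 1 : ℕ) : ℝ)) ^ 2) atTop
      (𝓝 (dWaveSourceEnergyDensityTT' t' U μ 0 - dWaveSourceEnergyDensityTT' t' U μ h)) := by
  have key := (tendsto_dWaveSourceEnergyDensityTT' t' U μ 0).sub (tendsto_dWaveSourceEnergyDensityTT' t' U μ h)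
  refine key.congr fun L => ?_
  rw [sub_div]

/-- **TL CEILING ON THE HELICITY CHORD DENSITY**: for every twist sequence `n_L` and every `ε > 0`, eventually
`(E₀(dWaveSourceTorusTT'Twist (L+1) t' U μ h (n L)) − E₀(A_{L+1}(h)))/(L+1)² ≤ e_src(0) − e_src(h) + ε`.
[cite: KomaTasaki1994, §1] -/
theorem eventually_sourcedHelicityChord_div_sq_le (t' U μ h : ℝ) (n : ∀ L : ℕ, Fin 2 → ZMod (L + 1))
    {ε : ℝ} (hε : 0 < ε) :
    ∀ᶠ L : ℕ in atTop,
      ((dWaveSourceTorusTT'Twist (L + 1) t' U μ h (n L)).groundEnergy -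
          (dWaveSourceTorusTT' (L + 1) t' U μ h).groundEnergy) / (((L + 1 : ℕ) : ℝ)) ^ 2 ≤
        dWaveSourceEnergyDensityTT' t' U μ 0 - dWaveSourceEnergyDensityTT' t' U μ h + ε := by
  have hlim := (tendsto_sourcedGain_div_sq t' U μ h).eventually
    (Iic_mem_nhds (lt_add_of_pos_right (dWaveSourceEnergyDensityTT' t' U μ 0 - dWaveSourceEnergyDensityTT' t' U μ h) hε))
  filter_upwards [hlim, eventually_ge_atTop 2] with L hL hL2
  have hL3 : 3 ≤ L + 1 := by omega
  have hpos : 0 < (((L + 1 : ℕ) : ℝ)) ^ 2 := by positivity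
  exact le_trans (div_le_div_of_nonneg_right (sourcedHelicityChord_le_sourcedGain (L + 1) hL3 t' U μ h (n L)) hpos.le)
    hL

/-- The thermodynamic sourced gain density is non-negative for `h ≥ 0` (`e_src` is non-increasing on `[0, ∞)`).
[cite: KomaTasaki1994, §1] -/
theorem sourcedGainDensity_nonneg (t' U μ : ℝ) {h : ℝ} (hh : 0 ≤ h) :
    0 ≤ dWaveSourceEnergyDensityTT' t' U μ 0 - dWaveSourceEnergyDensityTT' t' U μ h :=
  sub_nonneg.2 (dWaveSourceEnergyDensityTT'_anti t' U μ le_rfl hh)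

end Literature.MathematicalPhysics.QuantumLattice
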